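import Summits.AtomisticToContinuum.FouriersLaw.Theorems.BondHeatUncertaintyDefs
import Summits.AtomisticToContinuum.FouriersLaw.Theorems.BondHeatUncertaintySubdiffusiveBondHeatBathBondReductionFlowLaws

/-!
# Finite-bias Clausius (stub `stub_finiteBiasClausius`), helper 5: one-time laws along the forward path, Fubini for the work integral, and the integral fluctuation theorem ⇒ second law

Helper file for crux `stmt-AtomisticToContinuum-9122` (`BondHeatUncertainty.LinearResponseFTUR`), line
`lebesgue-flip-duality`, stub `stub_finiteBiasClausius`. Measure-theoretic plumbing of the transient
fluctuation theorem for the pinned chain started from an initial law `ν` (later: the Gibbs measure at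
`T_R`), driven by the Brownian pair (`Π = ν ⊗ W` on `PhaseSpace N × WienerPair`):

* `clausius_lintegral_comp_fwdPath`, `clausius_integral_comp_fwdPath` — the law of `X_s` under `Π` is
  `ν P_{s⁺}` (`…FlowLaws.pinnedChain_map_solMap_of_initial`), as integral identities;
* `clausius_integrable_of_le_exp` — observables dominated by `K e^{ϑH}` are integrable against any
  finite measure with `∫ e^{ϑH} ≤ M < ∞`, with `|∫ f| ≤ K M`;
* `clausius_workIntegral_fubini` — for continuous `f` with `|f| ≤ K e^{ϑH}` and uniform moments
  `∫ e^{ϑH} d(νP_s) ≤ M`, the work-type integral `∫₀ᵗ f(X_s) ds` is `Π`-integrable and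
  `E_Π ∫₀ᵗ f(X_s) ds = ∫₀ᵗ (νP_s)(f) ds` (Fubini) — registered sub-goal of the stub;
* `clausius_lintegral_gibbs_prod_eq_one` — an identity `∫dz E_W[ρ_T(z) F(z,·)] = ∫ ρ_T dz` on Lebesgue
  measure is `E_{μ_T ⊗ W}[F] = 1` for the Gibbs measure `μ_T = Z⁻¹ρ_T dz`;
* `integral_nonneg_of_lintegral_exp_neg_eq_one` — the integral fluctuation theorem `E e^{-Σ} = 1`
  implies the second law `E Σ ≥ 0` for integrable `Σ` (`e^{-x} ≥ 1 - x`; no convexity needed).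

Nothing here closes an item.
-/

noncomputable section

namespace Summit.AtomisticToContinuum.FouriersLaw.Theorems.LinearResponseFTUR

open MeasureTheory ProbabilityTheory Filter Topology Set
open scoped NNReal ENNReal
open Literature.MathematicalPhysics.KineticTheory
open Literature.MathematicalPhysics.KineticTheory.HeatConduction
open Literature.Probability.Process
open Summit.AtomisticToContinuum.FouriersLaw.Theorems.BondHeatUncertainty
open Summit.AtomisticToContinuum.FouriersLaw.Theorems.SubdiffusiveBondHeat
open OscillatorChain

/-! ### The integral fluctuation theorem implies the second law -/

/-- **`E e^{-Σ} = 1 ⟹ E Σ ≥ 0`.** On a probability space, if `Σ` is integrable and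
`∫ e^{-Σ} = 1` (Lebesgue form), then `0 ≤ ∫ Σ`: integrate the pointwise inequality `1 - Σ ≤ e^{-Σ}`. -/
theorem integral_nonneg_of_lintegral_exp_neg_eq_one {Ω : Type*} [MeasurableSpace Ω] {Q : Measure Ω}
    [IsProbabilityMeasure Q] {σ : Ω → ℝ} (hσ : Integrable σ Q)
    (h : ∫⁻ ω, ENNReal.ofReal (Real.exp (-σ ω)) ∂Q = 1) : 0 ≤ ∫ ω, σ ω ∂Q := by
  have hm : AEStronglyMeasurable (fun ω => Real.exp (-σ ω)) Q :=
    Real.continuous_exp.comp_aestronglyMeasurable hσ.1.neg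
  have hfin : HasFiniteIntegral (fun ω => Real.exp (-σ ω)) Q := by
    rw [hasFiniteIntegral_iff_ofReal (ae_of_all _ fun ω => (Real.exp_pos _).le), h]
    exact ENNReal.one_lt_top
  have hint : Integrable (fun ω => Real.exp (-σ ω)) Q := ⟨hm, hfin⟩
  have h1 : ∫ ω, Real.exp (-σ ω) ∂Q = 1 := by
    rw [integral_eq_lintegral_of_nonneg_ae (ae_of_all _ fun ω => (Real.exp_pos _).le) hm, h]
    simp
  have h2 : ∫ ω, (1 - σ ω) ∂Q ≤ ∫ ω, Real.exp (-σ ω) ∂Q :=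
    integral_mono ((integrable_const 1).sub hσ) hint fun ω => by
      have := Real.add_one_le_exp (-σ ω)
      simp only
      linarith
  rw [integral_sub (integrable_const 1) hσ, integral_const, h1] at h2
  simp only [probReal_univ, one_smul] at h2
  linarith

/-! ### The Gibbs start: from Lebesgue to `μ_T ⊗ W` -/

/-- **From a Lebesgue identity to the Gibbs product law.** For the pinned chain (`ω₂ > 0`,
`lam, β ≥ 0`, `T > 0`) and measurable `F ≥ 0` on `PhaseSpace N × WienerPair`: if
`∫ dz ∫ ρ_T(z) F(z, w) W(dw) = ∫ ρ_T dz` (`ρ_T = e^{-H/T}`), then `∫ F d(μ_T ⊗ W) = 1` for the Gibbs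
measure `μ_T = Z⁻¹ ρ_T dz` (`gibbsMeasure_eq_smul_withDensity`, Tonelli). -/
theorem clausius_lintegral_gibbs_prod_eq_one {ω₂ lam β : ℝ} (hω : 0 < ω₂) (hl : 0 ≤ lam) (hβ : 0 ≤ β)
    (γ : ℝ) (N : ℕ) {T : ℝ} (hT : 0 < T) {F : PhaseSpace N × WienerPair → ℝ≥0∞} (hF : Measurable F)
    (h : ∫⁻ z, ∫⁻ w, ENNReal.ofReal ((pinnedChain ω₂ lam β γ).gibbsDensity N T z) * F (z, w)
        ∂wienerPair = ∫⁻ z, ENNReal.ofReal ((pinnedChain ω₂ lam β γ).gibbsDensity N T z)) :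
    ∫⁻ p, F p ∂(((pinnedChain ω₂ lam β γ).gibbsMeasure N T).prod wienerPair) = 1 := by
  set P := pinnedChain ω₂ lam β γ with hP
  have hgi := pinnedChain_integrable_gibbsDensity hω hl hβ γ N hT
  have hgc := pinnedChain_continuous_gibbsDensity ω₂ lam β γ N T
  have hgm : Measurable fun z => ENNReal.ofReal (P.gibbsDensity N T z) :=
    P.measurable_gibbsDensity_ofReal hgc
  have hZ0 := P.partitionFunction_ne_zero (N := N) (T := T) hgc
  have hZt := P.partitionFunction_ne_top hgi
  rw [lintegral_prod _ hF.aemeasurable, P.gibbsMeasure_eq_smul_withDensity hgi,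
    lintegral_smul_measure, lintegral_withDensity_eq_lintegral_mul _ hgm hF.lintegral_prod_right']
  have h2 : ∫⁻ z, ((fun z => ENNReal.ofReal (P.gibbsDensity N T z)) *
      fun z => ∫⁻ w, F (z, w) ∂wienerPair) z =
      ∫⁻ z, ∫⁻ w, ENNReal.ofReal (P.gibbsDensity N T z) * F (z, w) ∂wienerPair := by
    refine lintegral_congr fun z => ?_
    simp only [Pi.mul_apply]
    exact (lintegral_const_mul _ (hF.comp (measurable_prodMk_left (x := z)))).symm
  rw [h2, h]
  exact ENNReal.inv_mul_cancel hZ0 hZt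

/-! ### Observables dominated by an exponential moment -/

/-- **Domination by `e^{ϑH}` gives integrability and an integral bound.** For a finite measure `ρ`
on phase space with `∫ e^{ϑH} dρ ≤ M < ∞` and a measurable `f` with `|f| ≤ K e^{ϑH}` (`K ≥ 0`):
`f ∈ L¹(ρ)` and `|∫ f dρ| ≤ K M`. -/
theorem clausius_integrable_of_le_exp {ω₂ lam β γ : ℝ} {N : ℕ} {ρ : Measure (PhaseSpace N)}
    [IsFiniteMeasure ρ] {ϑ : ℝ} {M : ℝ≥0∞} (hM : M ≠ ⊤)
    (hρ : ∫⁻ y, ENNReal.ofReal (Real.exp (ϑ * (pinnedChain ω₂ lam β γ).hamiltonian N y)) ∂ρ ≤ M)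
    {f : PhaseSpace N → ℝ} (hf : Measurable f) {K : ℝ} (hK : 0 ≤ K)
    (hfK : ∀ y, |f y| ≤ K * Real.exp (ϑ * (pinnedChain ω₂ lam β γ).hamiltonian N y)) :
    Integrable f ρ ∧ |∫ y, f y ∂ρ| ≤ K * M.toReal := by
  set P := pinnedChain ω₂ lam β γ with hP
  have hVm : Measurable fun y => Real.exp (ϑ * P.hamiltonian N y) :=
    Real.measurable_exp.comp ((pinnedChain_continuous_hamiltonian ω₂ lam β γ N).measurable.const_mul _)
  have hfin : ∫⁻ y, ENNReal.ofReal (Real.exp (ϑ * P.hamiltonian N y)) ∂ρ ≠ ⊤ :=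
    ne_top_of_le_ne_top hM hρ
  have hVint : Integrable (fun y => Real.exp (ϑ * P.hamiltonian N y)) ρ := by
    have h := integrable_toReal_of_lintegral_ne_top hVm.ennreal_ofReal.aemeasurable hfin
    refine h.congr (ae_of_all _ fun y => ?_)
    simp only [ENNReal.toReal_ofReal (Real.exp_pos _).le]
  have hVle : ∫ y, Real.exp (ϑ * P.hamiltonian N y) ∂ρ ≤ M.toReal := by
    rw [integral_eq_lintegral_of_nonneg_ae (ae_of_all _ fun y => (Real.exp_pos _).le)
      hVm.aestronglyMeasurable]
    exact ENNReal.toReal_mono hM hρ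
  have hint : Integrable f ρ := by
    refine (hVint.const_mul K).mono' hf.aestronglyMeasurable (ae_of_all _ fun y => ?_)
    rw [Real.norm_eq_abs]
    exact hfK y
  refine ⟨hint, ?_⟩
  calc |∫ y, f y ∂ρ| ≤ ∫ y, |f y| ∂ρ := abs_integral_le_integral_abs
    _ ≤ ∫ y, K * Real.exp (ϑ * P.hamiltonian N y) ∂ρ := integral_mono hint.abs (hVint.const_mul K) hfK
    _ = K * ∫ y, Real.exp (ϑ * P.hamiltonian N y) ∂ρ := integral_const_mul _ _
    _ ≤ K * M.toReal := mul_le_mul_of_nonneg_left hVle hK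

/-! ### One-time laws along the forward path and Fubini for the work integral -/

section Flow

variable {ω₂ lam β γ : ℝ} (hω : 0 < ω₂) (hl : 0 ≤ lam) (hβ : 0 ≤ β) (hγ : 0 ≤ γ) (N : ℕ)
  (T_L T_R : ℝ)
include hω hl hβ hγ

/-- **Law of `X_s` under `ν ⊗ W`, Lebesgue form**: `∫ f(X_s) d(ν ⊗ W) = ∫ f d(ν P_{s⁺})` for
measurable `f ≥ 0` and every real `s` (the forward path is clamped at the start for `s ≤ 0`). -/
theorem clausius_lintegral_comp_fwdPath (ν : Measure (PhaseSpace N)) [SFinite ν] (s : ℝ)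
    {f : PhaseSpace N → ℝ≥0∞} (hf : Measurable f) :
    ∫⁻ zw, f (fwdPath (pinnedChain ω₂ lam β γ) N T_L T_R zw.1 zw.2 s) ∂(ν.prod wienerPair) =
      ∫⁻ y, f y ∂(ν.bind ((pinnedChain ω₂ lam β γ).transitionKernel N T_L T_R s.toNNReal)) := by
  have hm := pinnedChain_measurable_solMap_pairPath hω hl hβ hγ N T_L T_R ((s.toNNReal : ℝ≥0) : ℝ)
  rw [← pinnedChain_map_solMap_of_initial hω hl hβ hγ N T_L T_R ν s.toNNReal, lintegral_map hf hm]
  refine lintegral_congr fun zw => ?_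
  show f ((pinnedChain ω₂ lam β γ).solMap N T_L T_R s zw.1 (pairPath zw.2)) = _
  rw [pinnedChain_solMap_eq_solMap_toNNReal N T_L T_R s]

/-- **Law of `X_s` under `ν ⊗ W`, Bochner form**: for measurable real `f` and real `s`,
`f(X_s) ∈ L¹(ν ⊗ W) ↔ f ∈ L¹(ν P_{s⁺})` and `∫ f(X_s) d(ν ⊗ W) = ∫ f d(ν P_{s⁺})`. -/
theorem clausius_integral_comp_fwdPath (ν : Measure (PhaseSpace N)) [SFinite ν] (s : ℝ)
    {f : PhaseSpace N → ℝ} (hf : Measurable f) :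
    (Integrable (fun zw : PhaseSpace N × WienerPair =>
        f (fwdPath (pinnedChain ω₂ lam β γ) N T_L T_R zw.1 zw.2 s)) (ν.prod wienerPair) ↔
      Integrable f (ν.bind ((pinnedChain ω₂ lam β γ).transitionKernel N T_L T_R s.toNNReal))) ∧
    ∫ zw, f (fwdPath (pinnedChain ω₂ lam β γ) N T_L T_R zw.1 zw.2 s) ∂(ν.prod wienerPair) =
      ∫ y, f y ∂(ν.bind ((pinnedChain ω₂ lam β γ).transitionKernel N T_L T_R s.toNNReal)) := by
  have hm := pinnedChain_measurable_solMap_pairPath hω hl hβ hγ N T_L T_R ((s.toNNReal : ℝ≥0) : ℝ)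
  have hX : (fun zw : PhaseSpace N × WienerPair =>
      f (fwdPath (pinnedChain ω₂ lam β γ) N T_L T_R zw.1 zw.2 s)) =
      f ∘ fun zw : PhaseSpace N × WienerPair =>
        (pinnedChain ω₂ lam β γ).solMap N T_L T_R ((s.toNNReal : ℝ≥0) : ℝ) zw.1 (pairPath zw.2) := by
    funext zw
    show f ((pinnedChain ω₂ lam β γ).solMap N T_L T_R s zw.1 (pairPath zw.2)) = _
    rw [pinnedChain_solMap_eq_solMap_toNNReal N T_L T_R s]
    rfl
  rw [hX, ← pinnedChain_map_solMap_of_initial hω hl hβ hγ N T_L T_R ν s.toNNReal]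
  exact ⟨(integrable_map_measure hf.aestronglyMeasurable hm.aemeasurable).symm,
    (integral_map hm.aemeasurable hf.aestronglyMeasurable).symm⟩

/-- **Fubini for the work-type integral `∫₀ᵗ f(X_s) ds`** (section form of the registered sub-goal
`clausius_workIntegral_fubini` below). For the pinned chain (`ω₂ > 0`, `lam, β, γ ≥ 0`), a probability measure
`ν` with uniform exponential moments along its orbit, `∫ e^{ϑH} d(νP_s) ≤ M < ∞`, a continuous `f`
with `|f| ≤ K e^{ϑH}` and `t ≥ 0`: `(z, w) ↦ ∫₀ᵗ f(X_s(z,w)) ds` is `ν ⊗ W`-integrable and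
`E_{ν ⊗ W} ∫₀ᵗ f(X_s) ds = ∫₀ᵗ (ν P_s)(f) ds` (joint measurability of the flow, Tonelli for the
`L¹` bound `≤ t K M`, Fubini). -/
theorem clausius_workIntegral_fubini_of (ν : Measure (PhaseSpace N)) [IsProbabilityMeasure ν]
    {ϑ : ℝ} {M : ℝ≥0∞} (hM : M ≠ ⊤)
    (hρ : ∀ s : ℝ≥0, ∫⁻ y, ENNReal.ofReal (Real.exp (ϑ * (pinnedChain ω₂ lam β γ).hamiltonian N y))
      ∂(ν.bind ((pinnedChain ω₂ lam β γ).transitionKernel N T_L T_R s)) ≤ M)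
    {f : PhaseSpace N → ℝ} (hf : Continuous f) {K : ℝ} (hK : 0 ≤ K)
    (hfK : ∀ y, |f y| ≤ K * Real.exp (ϑ * (pinnedChain ω₂ lam β γ).hamiltonian N y))
    {t : ℝ} (ht : 0 ≤ t) :
    Integrable (fun zw : PhaseSpace N × WienerPair =>
        ∫ s in (0:ℝ)..t, f (fwdPath (pinnedChain ω₂ lam β γ) N T_L T_R zw.1 zw.2 s))
      (ν.prod wienerPair) ∧
    ∫ zw, (∫ s in (0:ℝ)..t, f (fwdPath (pinnedChain ω₂ lam β γ) N T_L T_R zw.1 zw.2 s))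
        ∂(ν.prod wienerPair) =
      ∫ s in (0:ℝ)..t,
        ∫ y, f y ∂(ν.bind ((pinnedChain ω₂ lam β γ).transitionKernel N T_L T_R s.toNNReal)) := by
  set P := pinnedChain ω₂ lam β γ with hP
  set Q : Measure (PhaseSpace N × WienerPair) := ν.prod wienerPair with hQ
  set μt : Measure ℝ := volume.restrict (Ioc (0:ℝ) t) with hμt
  haveI : IsFiniteMeasure μt := by
    rw [hμt]; exact ⟨by simp [Real.volume_Ioc]⟩
  -- the integrand on `ℝ × (PhaseSpace N × WienerPair)` is jointly measurable
  set F : ℝ × (PhaseSpace N × WienerPair) → ℝ := fun q => f (fwdPath P N T_L T_R q.2.1 q.2.2 q.1)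
    with hFdef
  have hFm : Measurable F := by
    have h := hf.measurable.comp (pinnedChain_measurable_solMap_process hω hl hβ hγ N T_L T_R)
    exact h
  -- `L¹` bound on the product `μt ⊗ Q` by Tonelli and the one-time laws
  have hslice : ∀ s : ℝ, ∫⁻ zw, ‖F (s, zw)‖ₑ ∂Q ≤ ENNReal.ofReal K * M := by
    intro s
    have h1 : ∫⁻ zw, ‖F (s, zw)‖ₑ ∂Q = ∫⁻ y, ‖f y‖ₑ
        ∂(ν.bind (P.transitionKernel N T_L T_R s.toNNReal)) :=
      clausius_lintegral_comp_fwdPath hω hl hβ hγ N T_L T_R ν s hf.measurable.enorm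
    rw [h1]
    calc ∫⁻ y, ‖f y‖ₑ ∂(ν.bind (P.transitionKernel N T_L T_R s.toNNReal))
        ≤ ∫⁻ y, ENNReal.ofReal K * ENNReal.ofReal (Real.exp (ϑ * P.hamiltonian N y))
            ∂(ν.bind (P.transitionKernel N T_L T_R s.toNNReal)) := by
          refine lintegral_mono fun y => ?_
          rw [Real.enorm_eq_ofReal_abs, ← ENNReal.ofReal_mul hK]
          exact ENNReal.ofReal_le_ofReal (hfK y)
      _ ≤ ENNReal.ofReal K * M := by
          have hVm : Measurable fun y => ENNReal.ofReal (Real.exp (ϑ * P.hamiltonian N y)) :=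
            ENNReal.measurable_ofReal.comp (Real.measurable_exp.comp
              ((pinnedChain_continuous_hamiltonian ω₂ lam β γ N).measurable.const_mul _))
          rw [lintegral_const_mul _ hVm]
          exact mul_le_mul' le_rfl (hρ _)
  have hFint : Integrable F (μt.prod Q) := by
    refine ⟨hFm.aestronglyMeasurable, ?_⟩
    show ∫⁻ q, ‖F q‖ₑ ∂(μt.prod Q) < ⊤
    rw [lintegral_prod _ hFm.enorm.aemeasurable]
    calc ∫⁻ s, ∫⁻ zw, ‖F (s, zw)‖ₑ ∂Q ∂μt ≤ ∫⁻ _, ENNReal.ofReal K * M ∂μt :=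
          lintegral_mono fun s => hslice s
      _ = ENNReal.ofReal K * M * μt univ := lintegral_const _
      _ < ⊤ := ENNReal.mul_lt_top (ENNReal.mul_lt_top ENNReal.ofReal_lt_top hM.lt_top)
          (measure_lt_top _ _)
  -- integrability of the work integral
  have hWI : Integrable (fun zw => ∫ s, F (s, zw) ∂μt) Q := hFint.integral_prod_right
  have hWI_eq : (fun zw : PhaseSpace N × WienerPair =>
      ∫ s in (0:ℝ)..t, f (fwdPath P N T_L T_R zw.1 zw.2 s)) = fun zw => ∫ s, F (s, zw) ∂μt := by
    funext zw
    rw [intervalIntegral.integral_of_le ht]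
  refine ⟨by rw [hWI_eq]; exact hWI, ?_⟩
  -- Fubini
  rw [hWI_eq, intervalIntegral.integral_of_le ht]
  have hswap := integral_integral_swap (μ := Q) (ν := μt) (f := fun zw s => F (s, zw)) hFint.swap
  rw [hswap]
  refine setIntegral_congr_fun measurableSet_Ioc fun s _ => ?_
  exact (clausius_integral_comp_fwdPath hω hl hβ hγ N T_L T_R ν s hf.measurable).2

end Flow

/-- **Fubini for the work-type integral `∫₀ᵗ f(X_s) ds`** (registered sub-goal of
`stub_finiteBiasClausius`; `clausius_workIntegral_fubini_of` with all binders after the colon): for the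
pinned chain (`ω₂ > 0`, `lam, β, γ ≥ 0`), a probability measure `ν` with `∫ e^{ϑH} d(νP_s) ≤ M < ∞`, a
continuous `f` with `|f| ≤ K e^{ϑH}` and `t ≥ 0`, the integral `∫₀ᵗ f(X_s) ds` along the forward path is
`ν ⊗ W`-integrable with `E_{ν ⊗ W} ∫₀ᵗ f(X_s) ds = ∫₀ᵗ (νP_s)(f) ds`. -/
theorem clausius_workIntegral_fubini :
    ∀ {ω₂ lam β γ : ℝ}, 0 < ω₂ → 0 ≤ lam → 0 ≤ β → 0 ≤ γ → ∀ (N : ℕ) (T_L T_R : ℝ)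
    (ν : Measure (PhaseSpace N)) [IsProbabilityMeasure ν] {ϑ : ℝ} {M : ℝ≥0∞}, M ≠ ⊤ →
    (∀ s : ℝ≥0, ∫⁻ y, ENNReal.ofReal (Real.exp (ϑ * (pinnedChain ω₂ lam β γ).hamiltonian N y))
      ∂(ν.bind ((pinnedChain ω₂ lam β γ).transitionKernel N T_L T_R s)) ≤ M) →
    ∀ {f : PhaseSpace N → ℝ}, Continuous f → ∀ {K : ℝ}, 0 ≤ K →
    (∀ y, |f y| ≤ K * Real.exp (ϑ * (pinnedChain ω₂ lam β γ).hamiltonian N y)) → ∀ {t : ℝ}, 0 ≤ t →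
    Integrable (fun zw : PhaseSpace N × WienerPair => ∫ s in (0:ℝ)..t,
      f (fwdPath (pinnedChain ω₂ lam β γ) N T_L T_R zw.1 zw.2 s)) (ν.prod wienerPair) ∧
    ∫ zw, (∫ s in (0:ℝ)..t, f (fwdPath (pinnedChain ω₂ lam β γ) N T_L T_R zw.1 zw.2 s))
      ∂(ν.prod wienerPair) =
    ∫ s in (0:ℝ)..t, ∫ y, f y ∂(ν.bind ((pinnedChain ω₂ lam β γ).transitionKernel N T_L T_R s.toNNReal)) :=
  fun hω hl hβ hγ N T_L T_R ν _ _ _ hM hρ _ hf _ hK hfK _ ht =>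
    clausius_workIntegral_fubini_of hω hl hβ hγ N T_L T_R ν hM hρ hf hK hfK ht

end Summit.AtomisticToContinuum.FouriersLaw.Theorems.LinearResponseFTUR

end
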